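import Mathlib.Order.Partition.Finpartition
import Mathlib.LinearAlgebra.Matrix.Rank
import Literature.Combinatorics.Matroid.HeppBound
import Literature.Combinatorics.Matroid.VectorMatroid
import Literature.MathematicalPhysics.QuantumFieldTheory.GraphPeriod
import HarnessLib
import HarnessLib.Audit

/-!
# The Hepp bound and the Martin sequence of a Feynman graph; the faithfulness conjectures

Topic `MathematicalPhysics/QuantumFieldTheory` (second half of definition request `defn-heppBound`
of route `KontsevichZagierPeriods/PhiFourLaboratory`; the matroid-level Hepp bound is
`Literature/Combinatorics/Matroid/HeppBound.lean`). Sources read: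
E. Panzer, *Hepp's bound for Feynman graphs and matroids*, AIHPD 10 (2023) = arXiv:1908.09820
[Panzer2022] — §1 eqs. (1.2) (the period `P(G)` in the chart `x_N = 1`), (1.5) (the Hepp bound
`H(G) ∈ ℚ`, unit indices), (1.6) (`H(G)·|ST_G|^{-D/2} ≤ P(G) ≤ H(G)`), Conj. 1.2 ("Two `φ⁴`
graphs have equal periods if and only if they have equal Hepp bounds"; `φ⁴` = `D = 4` and all
degrees `≤ 4`), Def. 2.4, eq. (2.2) (loop number), Prop. 2.9, Prop. 3.2;
E. Panzer, K. Yeats, *Feynman symmetries of the Martin and `c₂` invariants of regular graphs*,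
Combinatorial Theory 5 (1) (2025) #10 = arXiv:2304.05299 [PanzerYeats2025] — Def. 1.1 (Martin
invariant `M(G)` of a `2k`-regular graph), Thm 1.3 ("the number of partitions of the edge set of
`G ∖ v` into `k` spanning trees is equal to `M(G)`", for every vertex `v`, `G` with `≥ 3`
vertices), Def. 1.7 (Martin sequence `M(G^[r])`, `G^[r]` = every edge replaced by `r` parallel
edges), Conj. 1.10, and p. 10 ("we could define the Martin sequence as this diagonal");
O. Schnetz, *Quantum periods*, CNTP 4 (2010) = arXiv:0801.2856 [Schnetz2010] — Def. 4 and Prop. 6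
("Let `Γ` be 4-regular and `v` a vertex. Then `Γ - v` is primitive iff `Γ` is completed
primitive"); O. Schnetz, *The five-twist identity for Feynman periods*, arXiv:2505.02578 (2025)
[Schnetz2025] — pp. 8–9 only, for the 2025 STATUS of the two conjectures (read 2026-08-16).

## Contents (namespace `Literature.MathematicalPhysics.QuantumFieldTheory`)

Graphs are edge lists `E : Fin N → Fin (V+1) × Fin (V+1)` as in `GraphPeriod.lean`, whose graphic
corank `loopNumber E γ = |γ| - rk ℰ_γ` (Panzer's `ℓ(γ)`, eq. (2.2)) is fed to the generic layer
`heppSumOfCorank` / `heppFlagSumOfCorank` of `Combinatorics/Matroid/HeppBound.lean`.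
* `cycleMatroid E` — the cycle matroid (vector matroid over `ℚ` of the incidence rows,
  `VectorMatroid.lean`), with `corank_cycleMatroid : corank (cycleMatroid E) γ = loopNumber E γ`
  (PROVED: matrix rank = dimension of the row span = matroid rank), so that every graph notion
  below is literally the matroid notion of `cycleMatroid E` (`graphHeppBoundDim_eq_heppBoundDim`,
  `graphHeppFlagSum_eq_heppFlagSum`) and the named fact `Panzer2022_prop_3_2` specialises to
  graphs (`graphHeppBoundDim_eq_graphHeppFlagSum`).
* `graphSdc`, `graphHeppBoundDim E D a` (`Hepp_D(G, a⃗)`, Def. 2.4), `graphLogDim`,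
  `graphHeppBound E a` (Def. 2.4 with `ω(G) = 0`), **`graphUnitHeppBound E : ℚ`** — `H(G)` of a
  `φ⁴` graph: unit indices in `D = 4` (eq. (1.5); `= graphHeppBound E 1` when `N = 2ℓ`,
  `graphHeppBound_one`), `graphHeppFlagSum` / `graphUnitHeppFlagSum` (Prop. 3.2's right-hand
  side; the unit version is the formula inlined by the route items).
* `graphPeriod E : ℝ` — the period `P(G) = ∫_{x>0} dx/Ψ_E(x,1)²` (eq. (1.2), `D = 4`; the value of
  `graphPeriodRep`).
* `edgeDup E r` (`G^[r]`), `IsSpanningTree`, `treePartitionCount E k` (number of partitions of the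
  edge set into `k` spanning trees), **`martinSequence k E r`** — for a decompletion `E = G ∖ v` of
  a `2k`-regular graph `G` this is `M(G^[r])` by PanzerYeats Thm 1.3, TAKEN AS THE DEFINITION.
* Registered OPEN CONJECTURES, not literature debt (CONVENTIONS §4: an open conjecture is a
  `def … : Prop`, never asserted; each carries the obligation tag `@[conjecture]`
  (`HarnessLib.Audit.Tags`: "open named conjecture", an obligation node, never a vendored fact), a
  docstring starting `OPEN CONJECTURE —` with the cite tag of where it is POSED and
  `[status: open]`, and has no `_holds` to expect): **`HeppFaithful`** (Panzer Conj. 1.2) and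
  **`MartinFaithful`** (PanzerYeats Conj. 1.10, over decompletions via Schnetz Prop. 6 and Thm 1.3),
  both for connected primitive-divergent `φ⁴` edge lists (the graphs that have periods). Verdict
  clean-ups 2026-08-16: statements byte-for-byte unchanged, `@[conjecture]` tags added; the names
  are kept WITHOUT the `…Conjecture` suffix although neither has a Lean user (the route theses
  `PhiFourHepp` / `PhiFourLaboratory` of `Summits/KontsevichZagierPeriods` mention them only in the
  prose of their definition requests), because a renamed declaration is a NEW conjecture-citing
  `Prop` in `Literature/`, which the gate refuses (`literature.conjecture` + D-0026
  `lint.fact-fanout`, net debt delta +2; dry-runs of three clean-up seats, generations 1, 3 and 4,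
  2026-08-16) — by the human ruling "conjectures live in our theories" a route that wants either
  one as a crux or as the premise of a conditional bridge re-files it problem-side as
  `Summits/<S>/<Sub>/Theorems/<Name>Conjecture.lean` (`@[conjecture] def`, same cite) and references
  it by name, the planner's call. The prove-seat's verdict `open-problem` was re-verified on the
  page (2026-08-16): [Panzer2022] p. 4 prints Conjecture 1.2 as a conjecture supported by data ("More
  than a thousand `φ⁴` periods are known, and they are all in agreement with"; §5.2 p. 34:
  "whenever two graphs share the same Hepp bound and their periods are known, then the periods
  indeed coincide"), [PanzerYeats2025] still treats it as open (§7.1 p. 66: "the Hepp bound is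
  expected to be a perfect period invariant for 4-regular graphs [57, Conjecture 1.2]"; footnote 23
  p. 70: "We do not know that the Hepp bounds give a lower bound on the number of periods … we
  expect that `P(G₁) = P(G₂)` implies `H(G₁) = H(G₂)`"), and [Schnetz2025] p. 8 reports the same in
  2025 ("In 2019, E. Panzer conjectured that a combinatorial invariant, the Hepp bound, can identify
  equal Feynman periods in `φ⁴` theory … This conjecture is supported by numerical evidence"; p. 9:
  the 8-loop identities `P₈,₃₀ = P₈,₃₆`, `P₈,₃₁ = P₈,₃₅` that faithfulness predicts are
  "conjectured" and "the five-twist is not powerful enough to explain" them), so neither direction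
  is proved; none of the 38 papers citing [Panzer2022] in the citation graph (2026-08-16) claims a
  proof. Likewise Conjecture 1.10 is posed on p. 8 of [PanzerYeats2025] and supported only by
  computation (§7.1 p. 66: "All this data constitutes our evidence for conjecture 1.10").
* ONE named fact `Panzer2022_period_le_hepp` (eq. (1.6), upper bound: `P(G) ≤ H(G)`), DISCHARGED:
  `Panzer2022_period_le_hepp_holds` in `HeppBoundProofs.lean` (this file therefore carries no open
  literature debt).

Deliberately NOT here: the Martin polynomial / transition recursion of Def. 1.1 and Thm 1.3 itself
(we define by its spanning-tree side), `c₂` and permanent residues (Thms 1.6, 1.8), the lower bound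
of (1.6) (needs `|ST_G| = Ψ_G(1)`, matrix-tree), connectedness of `cycleMatroid E` versus
biconnectivity of the graph (Panzer Lemma 2.18).
-/

noncomputable section

open Finset MeasureTheory
open Literature.Combinatorics.Matroid

namespace Literature.MathematicalPhysics.QuantumFieldTheory

/-! ### The Hepp bound of an edge list -/

section Hepp

variable {N V : ℕ} {𝕜 : Type*} [Field 𝕜]

/-- The superficial degree of convergence `ω(γ) = Σ_{e∈γ} a_e - (D/2)·h₁(γ)` of an edge subset of
the edge list `E` (Panzer 2022, §2.1, with the loop number (2.2) computed as
`loopNumber E γ = |γ| - rk ℰ_γ`). [cite: Panzer2022, §2.1 (definition of ω) and eq. (2.2)] -/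
def graphSdc (E : Fin N → Fin (V + 1) × Fin (V + 1)) (D : 𝕜) (a : Fin N → 𝕜)
    (γ : Finset (Fin N)) : 𝕜 :=
  sdcOfCorank (loopNumber E) D a γ

/-- Unfolding `graphSdc`. [folklore] -/
theorem graphSdc_apply (E : Fin N → Fin (V + 1) × Fin (V + 1)) (D : 𝕜) (a : Fin N → 𝕜)
    (γ : Finset (Fin N)) :
    graphSdc E D a γ = (∑ e ∈ γ, a e) - D / 2 * (loopNumber E γ : 𝕜) := rfl

/-- **The Hepp bound of a graph in dimension `D`**, `Hepp_D(G, a⃗) = Σ_σ Π_{k=1}^{N-1} ω(G^σ_k)⁻¹`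
(Panzer 2022, Def. 2.4), for an edge list with `N` edges. [cite: Panzer2022, Def. 2.4] -/
def graphHeppBoundDim (E : Fin N → Fin (V + 1) × Fin (V + 1)) (D : 𝕜) (a : Fin N → 𝕜) : 𝕜 :=
  heppSumOfCorank (loopNumber E) Finset.univ D a

/-- Unfolding `graphHeppBoundDim` to Def. 2.4's sum over the `N!` orderings of the edges. [cite: Panzer2022, Def. 2.4] -/
theorem graphHeppBoundDim_eq (E : Fin N → Fin (V + 1) × Fin (V + 1)) (D : 𝕜) (a : Fin N → 𝕜) :
    graphHeppBoundDim E D a =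
      ∑ l ∈ orderings (Finset.univ : Finset (Fin N)), ∏ k ∈ Finset.Ico 1 N,
        (graphSdc E D a (l.take k).toFinset)⁻¹ := by
  rw [graphHeppBoundDim, heppSumOfCorank_eq, Finset.card_univ, Fintype.card_fin]
  rfl

/-- The logarithmically divergent dimension `D = 2 (Σ_e a_e) / h₁(G)` (`ω(G) = 0`; Panzer 2022,
§2.1). [cite: Panzer2022, §2.1 (logarithmic divergence)] -/
def graphLogDim (E : Fin N → Fin (V + 1) × Fin (V + 1)) (a : Fin N → 𝕜) : 𝕜 :=
  logDimOfCorank (loopNumber E) Finset.univ a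

/-- **The Hepp bound `H(G, a⃗)`** of an edge list (Panzer 2022, Def. 2.4: `Hepp_D` at the
dimension where `ω(G) = 0`). [cite: Panzer2022, Def. 2.4] -/
def graphHeppBound (E : Fin N → Fin (V + 1) × Fin (V + 1)) (a : Fin N → 𝕜) : 𝕜 :=
  graphHeppBoundDim E (graphLogDim E a) a

/-- **The Hepp bound `H(G) ∈ ℚ` of a `φ⁴` graph**: unit indices `a_e = 1` in `D = 4` dimensions
(Panzer 2022, eq. (1.5) with Def. 2.4 / Prop. 2.9; "`G` is in `φ⁴` if it is in `D = 4` dimensions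
and every vertex has degree at most `4`"; e.g. `H(K₄) = 84`, Ex. 3.3). For a primitive-divergent
edge list (`N = 2 h₁`) `4` is the logarithmically divergent dimension, see `graphHeppBound_one`. [cite: Panzer2022, eq. (1.5) and Def. 2.4] -/
def graphUnitHeppBound (E : Fin N → Fin (V + 1) × Fin (V + 1)) : ℚ :=
  graphHeppBoundDim E (4 : ℚ) fun _ => 1

/-- For a logarithmically divergent edge list in four dimensions (`N = 2 h₁(G)`, e.g. primitive
divergent) the unit-index Hepp bound of Def. 2.4 is the `D = 4` value `graphUnitHeppBound`. [cite: Panzer2022, §2.1 (logarithmic divergence)] -/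
theorem graphHeppBound_one (E : Fin N → Fin (V + 1) × Fin (V + 1)) (hN : N ≠ 0)
    (h : N = 2 * loopNumber E Finset.univ) :
    graphHeppBound E (fun _ => (1 : ℚ)) = graphUnitHeppBound E := by
  have hl : (loopNumber E Finset.univ : ℚ) ≠ 0 := by
    intro h0
    have : loopNumber E Finset.univ = 0 := by exact_mod_cast h0
    omega
  have hD : graphLogDim E (fun _ => (1 : ℚ)) = 4 := by
    simp only [graphLogDim, logDimOfCorank, Finset.sum_const, Finset.card_univ, Fintype.card_fin,
      nsmul_eq_mul, mul_one]
    rw [div_eq_iff hl]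
    have h' : ((N : ℕ) : ℚ) = 2 * (loopNumber E Finset.univ : ℚ) := by exact_mod_cast h
    rw [h']
    ring
  rw [graphHeppBound, hD, graphUnitHeppBound]

/-- The bridgeless-flag sum of an edge list in dimension `D` (right-hand side of Panzer 2022,
Prop. 3.2, with `ℓ = loopNumber E`). [cite: Panzer2022, Prop. 3.2] -/
def graphHeppFlagSum (E : Fin N → Fin (V + 1) × Fin (V + 1)) (D : 𝕜) (a : Fin N → 𝕜) : 𝕜 :=
  heppFlagSumOfCorank (loopNumber E) Finset.univ D a

/-- The unit-index, `D = 4` bridgeless-flag sum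
`Σ_{γ_•} |γ₁|·|γ₂∖γ₁|⋯|E∖γ_{ℓ-1}| / Π_{k<ℓ} (|γ_k| - 2k)` over flags of bridgeless edge sets with
`h₁(γ_k) = k` (Panzer 2022, Prop. 3.2 at `a_e = 1`, `D = 4`): the formula by which the route
`PhiFourLaboratory` inlines the Hepp bound (`= graphUnitHeppBound E` for connected `E` with
`h₁ ≥ 1` off the poles, by the named fact `Panzer2022_prop_3_2` once `loopNumber` is identified with
the corank of the cycle matroid). [cite: Panzer2022, Prop. 3.2] -/
def graphUnitHeppFlagSum (E : Fin N → Fin (V + 1) × Fin (V + 1)) : ℚ :=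
  graphHeppFlagSum E (4 : ℚ) fun _ => 1

/-! #### The cycle matroid of an edge list; `loopNumber` is its corank -/

/-- **The cycle matroid** of the edge list `E` on its `N` edges: the vector matroid over `ℚ` of
the rows of the reduced incidence matrix `ℰ_E` (a forest = a set of edges with linearly
independent incidence vectors; Panzer 2022, Ex. 2.11; Oxley §1.1, §5.1). [cite: Panzer2022, Ex. 2.11 (cycle matroid)] -/
def cycleMatroid (E : Fin N → Fin (V + 1) × Fin (V + 1)) : Matroid (Fin N) :=
  vectorMatroid ℚ (fun e => reducedIncidence ℚ E e) Set.univ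

/-- The cycle matroid lives on all `N` edges (definitional). [folklore] -/
@[simp] theorem cycleMatroid_ground (E : Fin N → Fin (V + 1) × Fin (V + 1)) :
    (cycleMatroid E).E = Set.univ := rfl

/-- The ground finset of the cycle matroid is `Finset.univ`. [folklore] -/
@[simp] theorem groundFinset_cycleMatroid (E : Fin N → Fin (V + 1) × Fin (V + 1)) :
    groundFinset (cycleMatroid E) = Finset.univ := by
  ext e; simp

/-- **`edgeRank` is the rank in the cycle matroid**: the rank of the incidence rows of `γ` (matrix
rank over `ℚ`) is the matroid rank of `γ` (rank = dimension of the span of the rows). [folklore] -/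
theorem eRk_cycleMatroid_toNat (E : Fin N → Fin (V + 1) × Fin (V + 1)) (γ : Finset (Fin N)) :
    ((cycleMatroid E).eRk (γ : Set (Fin N))).toNat = edgeRank E γ := by
  rw [cycleMatroid, eRk_vectorMatroid_eq_finrank_span _ _ (Set.subset_univ _) γ.finite_toSet,
    ENat.toNat_coe, edgeRank, Matrix.rank_eq_finrank_span_row, Set.image_eq_range]
  rfl

/-- **`loopNumber` is the corank of the cycle matroid** (Panzer 2022, §2.3: "in the case of a
graphic matroid it is precisely the loop number (2.2)"). [cite: Panzer2022, §2.3 (corank of a graphic matroid)] -/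
theorem corank_cycleMatroid (E : Fin N → Fin (V + 1) × Fin (V + 1)) (γ : Finset (Fin N)) :
    corank (cycleMatroid E) γ = loopNumber E γ := by
  rw [corank, eRk_cycleMatroid_toNat, loopNumber]

/-- The graph Hepp bound in dimension `D` IS the matroid Hepp bound of the cycle matroid
(Panzer 2022, §2.3: the Hepp bound depends only on the cycle matroid). [cite: Panzer2022, §2.3] -/
theorem graphHeppBoundDim_eq_heppBoundDim (E : Fin N → Fin (V + 1) × Fin (V + 1)) (D : 𝕜)
    (a : Fin N → 𝕜) : graphHeppBoundDim E D a = heppBoundDim (cycleMatroid E) D a := by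
  have h : corank (cycleMatroid E) = loopNumber E := funext (corank_cycleMatroid E)
  rw [heppBoundDim, graphHeppBoundDim, groundFinset_cycleMatroid, h]

/-- The graph flag sum IS the matroid flag sum of the cycle matroid. [cite: Panzer2022, Prop. 3.2] -/
theorem graphHeppFlagSum_eq_heppFlagSum (E : Fin N → Fin (V + 1) × Fin (V + 1)) (D : 𝕜)
    (a : Fin N → 𝕜) : graphHeppFlagSum E D a = heppFlagSum (cycleMatroid E) D a := by
  have h : corank (cycleMatroid E) = loopNumber E := funext (corank_cycleMatroid E)
  rw [heppFlagSum, graphHeppFlagSum, groundFinset_cycleMatroid, h]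

/-- **The flag formula for graphs, from the named fact** `Panzer2022_prop_3_2`: for an edge list
with connected cycle matroid and `h₁ ≥ 1`, off the poles, Def. 2.4's Hepp bound equals the
bridgeless-flag sum (in particular, at unit indices in `D = 4` for primitive-divergent `φ⁴`
graphs, the route's inlined formula computes `graphUnitHeppBound`). [cite: Panzer2022, Prop. 3.2] -/
theorem graphHeppBoundDim_eq_graphHeppFlagSum (h : Panzer2022_prop_3_2) {𝕂 : Type} [Field 𝕂]
    [CharZero 𝕂] (E : Fin N → Fin (V + 1) × Fin (V + 1)) (hc : IsConnectedMatroid (cycleMatroid E))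
    (hl : 1 ≤ loopNumber E Finset.univ) (D : 𝕂) (a : Fin N → 𝕂)
    (hω : ∀ γ : Finset (Fin N), γ.Nonempty → γ ≠ Finset.univ → graphSdc E D a γ ≠ 0)
    (ha : ∀ e, a e ≠ 0) :
    graphHeppBoundDim E D a = graphHeppFlagSum E D a := by
  rw [graphHeppBoundDim_eq_heppBoundDim, graphHeppFlagSum_eq_heppFlagSum]
  refine h (cycleMatroid E) hc ?_ D a ?_ ?_
  · simpa [corank_cycleMatroid] using hl
  · intro γ _ hne hγ
    rw [groundFinset_cycleMatroid] at hγ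
    have : sdc (cycleMatroid E) D a γ = graphSdc E D a γ := by
      rw [sdc, graphSdc, funext (corank_cycleMatroid E)]
    rw [this]
    exact hω γ hne hγ
  · intro e _
    exact ha e

end Hepp

/-! ### The period as a number, the Hepp faithfulness conjecture, the Hepp bound as a bound -/

section Period

variable {n V : ℕ}

/-- **The period `P(G) ∈ ℝ`** of an edge list with `n + 1` edges:
`P(G) = ∫_{x ∈ (0,∞)ⁿ} dx / Ψ_E(x, 1)²` (Panzer 2022, eq. (1.2) in `D = 4`, the chart `x_N = 1`;
Schnetz 2010 (6e); the `value` of `graphPeriodRep`). Meaningful (absolutely convergent) exactly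
for connected primitive-divergent `E`; otherwise the Bochner integral's junk value. [cite: Panzer2022, eq. (1.2)] -/
def graphPeriod (E : Fin (n + 1) → Fin (V + 1) × Fin (V + 1)) : ℝ :=
  ∫ x in openOrthant n, graphPeriodIntegrand E x

/-- `graphPeriod` is the value of the parametric representation `graphPeriodRep` (definitional). [cite: Schnetz2010, Def.-Thm. 7 (6e)] -/
theorem value_graphPeriodRep_eq_graphPeriod (E : Fin (n + 1) → Fin (V + 1) × Fin (V + 1))
    (h0 : ∀ x ∈ openOrthant n, kirchhoffEval E (Fin.snoc x (1 : ℝ) : Fin (n + 1) → ℝ) ≠ 0)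
    (hint : IntegrableOn (graphPeriodIntegrand E) (openOrthant n)) :
    (graphPeriodRep E h0 hint).value = graphPeriod E := rfl

/-- OPEN CONJECTURE — [cite: Panzer2022, Conj. 1.2] [status: open] — **Hepp faithfulness**, POSED
in E. Panzer, *Hepp's bound for Feynman graphs and matroids*, AIHPD 10 (2023) 31–119 =
arXiv:1908.09820, §1 p. 4, Conjecture 1.2: "More than a thousand `φ⁴` periods are known
[PanzerSchnetz:Phi4Coaction], and they are all in agreement with: **Conjecture 1.2.** Two `φ⁴`
graphs have equal periods if and only if they have equal Hepp bounds." (ibid.: "we say that a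
graph `G` is in `φ⁴` if it is in `D = 4` dimensions and every vertex has degree at most `4`").
A CONJECTURE where it is printed, proved nowhere in either direction. The paper's own evidence is
computational (§5.2 p. 34: "We computed the Hepp bounds for all primitive `φ⁴` graphs with
`ℓ ≤ 11` loops, and whenever two graphs share the same Hepp bound and their periods are known,
then the periods indeed coincide"); Panzer–Yeats 2025 still cite it as an expectation (§7.1 p. 66:
"the Hepp bound is expected to be a perfect period invariant for 4-regular graphs
[57, Conjecture 1.2]"; footnote 23 p. 70: "We do not know that the Hepp bounds give a lower bound
on the number of periods in this context, but we do expect it. Specifically, we expect that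
`P(G₁) = P(G₂)` implies `H(G₁) = H(G₂)`"); O. Schnetz, *The five-twist identity for Feynman
periods*, arXiv:2505.02578 (2025) [Schnetz2025], p. 8, reports the same status ("In 2019,
E. Panzer conjectured that a combinatorial invariant, the Hepp bound, can identify equal Feynman
periods in `φ⁴` theory … This conjecture is supported by numerical evidence") and p. 9 calls the
8-loop identities it predicts "conjectured"; none of the 38 papers citing [Panzer2022] in the
citation graph (checked 2026-08-16) claims a proof of either implication. Registered as an OPEN
STATEMENT (CONVENTIONS §4; obligation tag `@[conjecture]`), not a named fact: there is no
`HeppFaithful_holds` to expect; users take `(h : HeppFaithful)` as an explicit hypothesis or attack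
an instance (verdict clean-ups 2026-08-16: statement unchanged, tag added; name kept without the
`…Conjecture` suffix — no Lean user, but a renamed declaration is a new conjecture-citing `Prop` in
`Literature/`, refused by the gate as `literature.conjecture` / `lint.fact-fanout`; a route wanting
it as a crux re-files it problem-side as `Summits/…/Theorems/HeppFaithfulConjecture.lean`).
Formalisation: `φ⁴` graphs are taken as connected primitive-divergent edge lists with all degrees
`≤ 4` — the graphs whose period (1.2) converges (Panzer §1; Schnetz 2010 Prop. 6) — and the Hepp
bound is the unit-index `D = 4` value `H(G) ∈ ℚ` (`graphUnitHeppBound`). The first unexplained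
coincidences are the 8-loop pairs of eq. (1.8), `H(P₈,₃₀∖v) = H(P₈,₃₆∖v) = 1724488/3` and
`H(P₈,₃₁∖v) = H(P₈,₃₅∖v) = 536760` (still "conjectured" period identities in [Schnetz2025],
eq. (22)). -/
@[conjecture] def HeppFaithful : Prop :=
  ∀ {n₁ V₁ n₂ V₂ : ℕ} (E₁ : Fin (n₁ + 1) → Fin (V₁ + 1) × Fin (V₁ + 1))
    (E₂ : Fin (n₂ + 1) → Fin (V₂ + 1) × Fin (V₂ + 1)),
    IsPhiFour E₁ → IsConnectedEdgeList E₁ → IsPrimitiveDivergent E₁ →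
    IsPhiFour E₂ → IsConnectedEdgeList E₂ → IsPrimitiveDivergent E₂ →
      (graphPeriod E₁ = graphPeriod E₂ ↔ graphUnitHeppBound E₁ = graphUnitHeppBound E₂)

/-- **The Hepp bound bounds the period** (named fact; Panzer 2022, eq. (1.6), upper half:
`P(G) ≤ H(G)`, from `Ψ^trop_G ≤ Ψ_G`; with Prop. 2.9 identifying the integral (1.5) with Def. 2.4
at unit indices, which lie in the convergence cone exactly for primitive-divergent `G`). [cite: Panzer2022, eq. (1.6)] -/
def Panzer2022_period_le_hepp : Prop :=
  ∀ {n V : ℕ} (E : Fin (n + 1) → Fin (V + 1) × Fin (V + 1)),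
    IsConnectedEdgeList E → IsPrimitiveDivergent E →
      graphPeriod E ≤ (graphUnitHeppBound E : ℝ)

end Period

/-! ### Spanning-tree partitions and the Martin sequence -/

section Martin

variable {N V : ℕ}

/-- **Edge duplication `G^[r]`**: every edge replaced by a bundle of `r` parallel edges
(PanzerYeats 2025, before Def. 1.7); the copy `(e, i)`, `i < r`, of edge `e` is indexed by
`finProdFinEquiv (e, i) : Fin (N * r)`. [cite: PanzerYeats2025, Def. 1.7 (G^[r])] -/
def edgeDup (E : Fin N → Fin (V + 1) × Fin (V + 1)) (r : ℕ) :
    Fin (N * r) → Fin (V + 1) × Fin (V + 1) :=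
  fun i => E (finProdFinEquiv.symm i).1

/-- The endpoints of a duplicated edge are those of the original (definitional). [folklore] -/
@[simp] theorem edgeDup_apply (E : Fin N → Fin (V + 1) × Fin (V + 1)) (r : ℕ) (e : Fin N)
    (i : Fin r) : edgeDup E r (finProdFinEquiv (e, i)) = E e := by
  simp [edgeDup]

/-- An edge subset `T` is a **spanning tree** of the edge list on the `V + 1` vertices: it has
`V` edges and is connected and spanning, i.e. its incidence rows have full rank `V`
(PanzerYeats 2025, §1.1: "a subset of the edges such that `T` has `n - 1` elements and forms a
connected subgraph"). [cite: PanzerYeats2025, §1.1 (spanning tree)] -/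
def IsSpanningTree (E : Fin N → Fin (V + 1) × Fin (V + 1)) (T : Finset (Fin N)) : Prop :=
  T.card = V ∧ edgeRank E T = V

/-- **The number of partitions of the edge set into `k` spanning trees** (PanzerYeats 2025,
Thm 1.3; set partitions, unordered, as in the `K₄` example (1.6) with `6` partitions into pairs). [cite: PanzerYeats2025, Thm 1.3] -/
def treePartitionCount (E : Fin N → Fin (V + 1) × Fin (V + 1)) (k : ℕ) : ℕ :=
  Nat.card {P : Finpartition (Finset.univ : Finset (Fin N)) //
    P.parts.card = k ∧ ∀ T ∈ P.parts, IsSpanningTree E T}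

/-- **The Martin sequence**, spanning-tree form (PanzerYeats 2025, Def. 1.7 with Thm 1.3, TAKEN AS
THE DEFINITION as suggested on p. 10 ibid.): for an edge list `E` and `r ≥ 1`,
`martinSequence k E r` is the number of partitions of the edges of `E^[r]` into `k·r` spanning
trees. When `E = G ∖ v` is a decompletion of a `2k`-regular graph `G` with at least `3` vertices,
this equals the Martin invariant `M(G^[r])` of Def. 1.1 (transition recursion) by Thm 1.3 applied
to the `2kr`-regular graph `G^[r]`, whose decompletion is `E^[r]`; `φ⁴` is `k = 2`
(e.g. `M(K₅) = 6` partitions of `K₄` into two spanning trees, (1.6)). [cite: PanzerYeats2025, Def. 1.7 and Thm 1.3] -/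
def martinSequence (k : ℕ) (E : Fin N → Fin (V + 1) × Fin (V + 1)) (r : ℕ) : ℕ :=
  treePartitionCount (edgeDup E r) (k * r)

/-- OPEN CONJECTURE — [cite: PanzerYeats2025, Conj. 1.10] [status: open] — **Martin faithfulness**,
POSED in E. Panzer, K. Yeats, *Feynman symmetries of the Martin and `c₂` invariants of regular
graphs*, Combinatorial Theory 5 (1) (2025) #10 = arXiv:2304.05299, §1.3 p. 8, Conjecture 1.10:
"Comparing with the known periods [7, 58] and the Hepp bound, supports the following conjecture
(we state a 3-regular version in conjecture 7.2). **Conjecture 1.10.** Cyclically 6-connected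
4-regular graphs `G₁` and `G₂` have equal period `P(G₁∖v₁) = P(G₂∖v₂)` if and only if they have
equal Martin sequences `M(G₁^•) = M(G₂^•)`." A CONJECTURE where it is printed, supported by
computation only (§7.1 p. 66: "All this data constitutes our evidence for conjecture 1.10"); no
proof of the equivalence is in print ([Schnetz2025] p. 9, 2025: the Martin sequence "is proved to
be invariant under all known identities of the period", while the 8-loop period identities it
predicts remain "conjectured"). Registered as an OPEN STATEMENT (CONVENTIONS §4; obligation tag
`@[conjecture]`), not a named fact: there is no `MartinFaithful_holds` to expect; users take
`(h : MartinFaithful)` as an explicit hypothesis or attack an instance (verdict clean-ups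
2026-08-16: statement unchanged, tag added; name kept for the same gate reason as `HeppFaithful`,
no Lean users).
Formalisation: stated over the decompletions `Eᵢ = Gᵢ ∖ vᵢ`, which are exactly the connected
primitive-divergent `φ⁴` edge lists (Schnetz 2010, Def. 4 and Prop. 6: `Γ - v` is primitive iff
`Γ` is completed primitive, i.e. cyclically 6-connected), with `M(Gᵢ^[r])` in the spanning-tree
form of Thm 1.3 (`martinSequence 2`). -/
@[conjecture] def MartinFaithful : Prop :=
  ∀ {n₁ V₁ n₂ V₂ : ℕ} (E₁ : Fin (n₁ + 1) → Fin (V₁ + 1) × Fin (V₁ + 1))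
    (E₂ : Fin (n₂ + 1) → Fin (V₂ + 1) × Fin (V₂ + 1)),
    IsPhiFour E₁ → IsConnectedEdgeList E₁ → IsPrimitiveDivergent E₁ →
    IsPhiFour E₂ → IsConnectedEdgeList E₂ → IsPrimitiveDivergent E₂ →
      (graphPeriod E₁ = graphPeriod E₂ ↔
        ∀ r : ℕ, 1 ≤ r → martinSequence 2 E₁ r = martinSequence 2 E₂ r)

end Martin

end Literature.MathematicalPhysics.QuantumFieldTheory
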